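import Summits.NavierStokesRegularity.FluidComputer.AngularGalerkinLadderRotation

/-!
# The angular Galerkin ladder: the rung-profile and window classes are invariant under rotations
# and reflections about the centre (theorems only)

Cell `ns-blowup`, seat `ns-blowup-lean` (g10). LABEL: KERNEL typing hygiene for the vocabulary of
`FluidComputer/AngularGalerkinLadder.lean` (route `Theses/AngularGalerkinLadder.lean`). WHAT THIS IS
NOT: not Navier–Stokes evidence — bookkeeping of the rotation symmetry on the typed classes
`IsRungProfile`, `IsWindowProfile`, `RungIsSingular`; no profile is constructed, nothing is
asserted about the existence of singular rungs.

## Content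

For a linear isometry `Q` of `ℝ³` and `ρ(Q)u (t, x) = Q u(t, Q⁻¹x)`:

* `hasTypeIDecay_conj`, `hasDefectBound_conj`: the Type-I weight `C₀/(‖x‖ + √−t)` and the
  defect weight `ε/(‖x‖ + √−t)³` are rotation invariant;
* `isRotatedDSS_conj`: a `(c, R)`-rotated-DSS field conjugated by `Q` is `(c, Q R Q⁻¹)`-rotated-DSS
  (`Q R Q⁻¹ = (Q⁻¹.trans R).trans Q`);
* `IsRungProfile.conj_linearIsometryEquiv`, `IsWindowProfile.conj_linearIsometryEquiv`,
  `RungIsSingular.conj` (trivial restatement): the Type-I rotated-DSS ancient rung-`L` profile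
  class and the window class `(C₀, [c_min, c_max], δ, ε)` are mapped to themselves by every
  rotation/reflection about the centre, with the SAME constants and the conjugated DSS rotation —
  so in the cruxes `NoOverheating` / `LimitTransfer` the DSS rotations `R_n` may be conjugated at
  will (e.g. brought to a normal form) without leaving the window.

References: [cite: ChaeWolf2017, Def. 1.1] (rotated DSS); [cite: KNSS2009, (1.6)] (Type-I weight);
[cite: MajdaBertozziCUP2002, §1.2 Prop. 1.1] (rotation symmetry).
-/

noncomputable section

namespace Summit.NavierStokesRegularity.FluidComputer

open Set MeasureTheory Filter Topology Function
open scoped ContDiff RealInnerProductSpace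
open Literature.Analysis.FluidPDE

namespace AngularLadder

variable {L : ℕ} {C₀ cmin cmax δ ε c : ℝ}
  {R : EuclideanSpace ℝ (Fin 3) ≃ₗᵢ[ℝ] EuclideanSpace ℝ (Fin 3)}
  {u : ℝ → EuclideanSpace ℝ (Fin 3) → EuclideanSpace ℝ (Fin 3)}
  {p : ℝ → EuclideanSpace ℝ (Fin 3) → ℝ}
  {d : ℝ → EuclideanSpace ℝ (Fin 3) → EuclideanSpace ℝ (Fin 3)}

/-- **The Type-I weight is rotation invariant**: `‖Q u(t, Q⁻¹x)‖ ≤ C₀/(‖x‖ + √−t)`. [folklore] -/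
theorem hasTypeIDecay_conj (h : HasTypeIDecay C₀ u)
    (Q : EuclideanSpace ℝ (Fin 3) ≃ₗᵢ[ℝ] EuclideanSpace ℝ (Fin 3)) :
    HasTypeIDecay C₀ fun t x => Q (u t (Q.symm x)) := by
  intro t ht x
  have key := h t ht (Q.symm x)
  rw [LinearIsometryEquiv.norm_map] at key
  simpa only [LinearIsometryEquiv.norm_map] using key

/-- **The scale-invariant defect weight is rotation invariant.** [folklore] -/
theorem hasDefectBound_conj (h : HasDefectBound ε d)
    (Q : EuclideanSpace ℝ (Fin 3) ≃ₗᵢ[ℝ] EuclideanSpace ℝ (Fin 3)) :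
    HasDefectBound ε fun t x => Q (d t (Q.symm x)) := by
  intro t ht x
  have key := h t ht (Q.symm x)
  rw [LinearIsometryEquiv.norm_map] at key
  simpa only [LinearIsometryEquiv.norm_map] using key

/-- **Rotated discrete self-similarity under conjugation**: if `u` is `(c, R)`-rotated-DSS then
`ρ(Q)u` is `(c, Q R Q⁻¹)`-rotated-DSS. [cite: ChaeWolf2017, Def. 1.1] -/
theorem isRotatedDSS_conj (h : IsRotatedDSS c R u)
    (Q : EuclideanSpace ℝ (Fin 3) ≃ₗᵢ[ℝ] EuclideanSpace ℝ (Fin 3)) :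
    IsRotatedDSS c ((Q.symm.trans R).trans Q) fun t x => Q (u t (Q.symm x)) := by
  intro t x
  have key := h t (Q.symm x)
  simp only [LinearIsometryEquiv.symm_trans, LinearIsometryEquiv.trans_apply,
    LinearIsometryEquiv.symm_symm, LinearIsometryEquiv.map_smul,
    LinearIsometryEquiv.symm_apply_apply]
  rw [← LinearIsometryEquiv.map_smul, key]

/-- **The rung-profile class is rotation invariant**: conjugating a Type-I rotated-DSS ancient
rung-`L` profile `(u, p, d)` with constants `(C₀, c, R)` by a linear isometry `Q` gives one with
constants `(C₀, c, Q R Q⁻¹)`. [folklore] -/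
theorem IsRungProfile.conj_linearIsometryEquiv (h : IsRungProfile L C₀ c R u p d)
    (Q : EuclideanSpace ℝ (Fin 3) ≃ₗᵢ[ℝ] EuclideanSpace ℝ (Fin 3)) :
    IsRungProfile L C₀ c ((Q.symm.trans R).trans Q) (fun t x => Q (u t (Q.symm x)))
      (fun t x => p t (Q.symm x)) (fun t x => Q (d t (Q.symm x))) :=
  ⟨h.1.conj_linearIsometryEquiv_Iio Q, h.2.1, isRotatedDSS_conj h.2.2.1 Q,
    hasTypeIDecay_conj h.2.2.2 Q⟩

/-- **The window class is rotation invariant**: same Type-I constant, same DSS-factor window,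
same amplitude floor `δ` at `t = −1` (attained at the rotated point), same defect size `ε`.
[folklore] -/
theorem IsWindowProfile.conj_linearIsometryEquiv (h : IsWindowProfile L C₀ cmin cmax δ ε c R u p d)
    (Q : EuclideanSpace ℝ (Fin 3) ≃ₗᵢ[ℝ] EuclideanSpace ℝ (Fin 3)) :
    IsWindowProfile L C₀ cmin cmax δ ε c ((Q.symm.trans R).trans Q)
      (fun t x => Q (u t (Q.symm x))) (fun t x => p t (Q.symm x))
      (fun t x => Q (d t (Q.symm x))) := by
  obtain ⟨hP, hc1, hc2, ⟨x₀, hx₀⟩, hdef⟩ := h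
  refine ⟨hP.conj_linearIsometryEquiv Q, hc1, hc2, ⟨Q x₀, ?_⟩, hasDefectBound_conj hdef Q⟩
  simpa only [LinearIsometryEquiv.symm_apply_apply, LinearIsometryEquiv.norm_map] using hx₀

/-- A conjugate of a nontrivial profile is nontrivial; hence the conjugated profile witnesses the
same `RungIsSingular L` (restatement for convenience). [folklore] -/
theorem RungIsSingular.of_conj_profile (h : IsRungProfile L C₀ c R u p d)
    (hnt : ∃ t < 0, ∃ x, u t x ≠ 0)
    (Q : EuclideanSpace ℝ (Fin 3) ≃ₗᵢ[ℝ] EuclideanSpace ℝ (Fin 3)) :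
    ∃ t < 0, ∃ x, (fun t x => Q (u t (Q.symm x))) t x ≠ 0 ∧
      IsRungProfile L C₀ c ((Q.symm.trans R).trans Q) (fun t x => Q (u t (Q.symm x)))
        (fun t x => p t (Q.symm x)) (fun t x => Q (d t (Q.symm x))) := by
  obtain ⟨t, ht, x, hx⟩ := hnt
  refine ⟨t, ht, Q x, ?_, h.conj_linearIsometryEquiv Q⟩
  intro h0
  apply hx
  have : Q (u t x) = 0 := by simpa [LinearIsometryEquiv.symm_apply_apply] using h0
  exact (map_eq_zero_iff Q Q.injective).1 this

end AngularLadder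

end Summit.NavierStokesRegularity.FluidComputer

end
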